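import Summits.CriticalPhenomena.CardyFormulaZ2.Theses.CardyBoundaryCoulombGas
import Literature.Probability.LatticeModels.CollarLegModel
import Literature.Probability.LatticeModels.DirichletGreenFunction
import Summits.CriticalPhenomena.CardyFormulaZ2.Theorems.CardyBoundaryCoulombGasBoundaryDefectGaussianRStubTransportPathsPart4
import Summits.CriticalPhenomena.CardyFormulaZ2.Theorems.CardyBoundaryCoulombGasBoundaryDefectGaussianRStubTransportPathsPart8
import Summits.CriticalPhenomena.CardyFormulaZ2.Theorems.CardyBoundaryCoulombGasBoundaryDefectGaussianRStubTransportPathsPart19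
import Summits.CriticalPhenomena.CardyFormulaZ2.Theorems.CardyBoundaryCoulombGasBoundaryDefectGaussianRStubTransportPathsPart20
import Summits.CriticalPhenomena.CardyFormulaZ2.Theorems.CardyBoundaryCoulombGasBoundaryDefectGaussianRStubTransportPathsPart32
import Summits.CriticalPhenomena.CardyFormulaZ2.Theorems.CardyBoundaryCoulombGasBoundaryDefectGaussianRStubTransportPathsPart33

/-!
# Stub `stub_transportPaths` of line `rainbow-monomials-in-excursion-kernels` (skeleton v2) — crux `BoundaryDefectGaussianR` (stmt-CriticalPhenomena-14132)

Work file for one REGISTERED stub (name + one-line signature registered on the crux item with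
`ledger workitem stub-add`; the theorem below states it verbatim). Helper lemmas live in this file (or Part files).
Target: `Summits/CriticalPhenomena/CardyFormulaZ2/Theorems/CardyBoundaryCoulombGasBoundaryDefectGaussianRStubTransportPaths.lean`
(`ledger propose --target <that> --file work/stubs/stub_transportPaths.lean --supports stmt-CriticalPhenomena-14132`).
-/

noncomputable section

open Set Filter Metric Topology Literature.Probability.RandomPlanarGeometry
open Literature.Probability.LatticeModels Literature.Probability.LatticeModels.CollarLegModel
open Summit.CriticalPhenomena.CardyFormulaZ2.Cruxes.RectilinearCardy.ExcursionKernelCovariance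

namespace Summit.CriticalPhenomena.CardyFormulaZ2.Cruxes.BoundaryDefectGaussianR.RainbowMonomialsInExcursionKernels

/-- The insertion points of an admissible datum are vertices with one outside neighbour.
[folklore] -/
theorem tp_points_of_admissible {k : ℕ} (L : Fin k → ℕ) (j : Fin k) (V : Finset (ℤ × ℤ))
    (p : Fin k → ℤ × ℤ)
    (hadm : LegInsertionData.IsAdmissible (⟨(Finset.univ.erase j).image p, fun v ↦
      ∑ b ∈ (Finset.univ.erase j).filter (fun b ↦ p b = v), L b, p j⟩ : LegInsertionData) V)
    (i : Fin k) : p i ∈ V ∧ ((neighbours (p i)).filter (fun y => y ∉ V)).card = 1 := by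
  classical
  obtain ⟨d₀, -, -, -, -, hall⟩ := s3_of_admissible _ V hadm
  have hmem : p i ∈ insert (p j) ((Finset.univ.erase j).image p) := by
    by_cases hij : i = j
    · rw [hij]; exact Finset.mem_insert_self _ _
    · exact Finset.mem_insert_of_mem (Finset.mem_image_of_mem p (Finset.mem_erase.2
        ⟨hij, Finset.mem_univ _⟩))
  obtain ⟨h1, h2, -⟩ := hall (p i) hmem
  exact ⟨h1, h2⟩

/-- **Registered sub-goal `s7_pointsOfAdmissible` of stub `stub_transportPaths`** (insertion points
of an admissible datum have one outside neighbour; `tp_lattice_stage` exceeds the cap).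
[folklore] -/
theorem s7_pointsOfAdmissible : ∀ (k : ℕ) (L : Fin k → ℕ) (j : Fin k) (V : Finset (ℤ × ℤ)) (p : Fin k → ℤ × ℤ), (Literature.Probability.LatticeModels.CollarLegModel.LegInsertionData.IsAdmissible (⟨(Finset.univ.erase j).image p, fun v ↦ ∑ b ∈ (Finset.univ.erase j).filter (fun b ↦ p b = v), L b, p j⟩ : Literature.Probability.LatticeModels.CollarLegModel.LegInsertionData) V) → ∀ (i : Fin k), p i ∈ V ∧ ((Literature.Probability.LatticeModels.CollarLegModel.neighbours (p i)).filter (fun y => y ∉ V)).card = 1 :=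
  fun _ L j V p hadm i => tp_points_of_admissible L j V p hadm i

set_option maxHeartbeats 4000000 in
/-- **The lattice stage of TRANSPORT.** See the module docstring. [folklore] -/
theorem tp_lattice_stage {k : ℕ} (D : MarkedDomain k) (L : Fin k → ℕ) (j : Fin k) {M : ℕ} {c : ℤ → ℝ}
    {a τ : ℤ → ℕ} (hM2 : 2 ≤ M) (hcmono : StrictMono c) (hcper : ∀ z, c (z + M) = c z + 1)
    (ha4 : ∀ z, a z < 4) (hτ : ∀ z, τ z = 1 ∨ τ z = 3)
    (hmodτ : ∀ z, (a z + τ z) % 4 = (a (z - 1) + 2) % 4)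
    (hdir : ∀ z, ∀ t ∈ Icc (c z) (c (z + 1)), D.boundary t =
      D.boundary (c z) + ((‖D.boundary t - D.boundary (c z)‖ : ℝ) : ℂ) * Complex.I ^ (a z))
    (hmono : ∀ z, StrictMonoOn (fun t => ‖D.boundary t - D.boundary (c z)‖) (Icc (c z) (c (z + 1))))
    (hflatch : ∀ z, ∀ t ∈ Ioo (c z) (c (z + 1)), ∃ r : ℝ, 0 < r ∧ (∀ w, dist w (D.boundary t) < r
      → (w ∈ frontier D.carrier ↔ (((w - D.boundary t) * (-Complex.I) ^ a z).im = 0 ∧ 0 ≤ ((w -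
      D.boundary t) * (-Complex.I) ^ a z).re) ∨ (((w - D.boundary t) * (-Complex.I) ^ (a z +
      2)).im = 0 ∧ 0 ≤ ((w - D.boundary t) * (-Complex.I) ^ (a z + 2)).re))) ∧ (∀ w, dist w
      (D.boundary t) < r → (w ∈ D.carrier ↔ ((2 = 1 → 0 < ((w - D.boundary t) * (-Complex.I) ^ a
      z).re ∧ 0 < ((w - D.boundary t) * (-Complex.I) ^ a z).im) ∧ (2 = 2 → 0 < ((w - D.boundary t)
      * (-Complex.I) ^ a z).im) ∧ (2 = 3 → 0 < ((w - D.boundary t) * (-Complex.I) ^ a z).im ∨ ((w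
      - D.boundary t) * (-Complex.I) ^ a z).re < 0)))) ∧ (∀ w, dist w (D.boundary t) < r → (w ∈
      closure D.carrier ↔ ((2 = 1 → 0 ≤ ((w - D.boundary t) * (-Complex.I) ^ a z).re ∧ 0 ≤ ((w -
      D.boundary t) * (-Complex.I) ^ a z).im) ∧ (2 = 2 → 0 ≤ ((w - D.boundary t) * (-Complex.I) ^
      a z).im) ∧ (2 = 3 → 0 ≤ ((w - D.boundary t) * (-Complex.I) ^ a z).im ∨ ((w - D.boundary t) *
      (-Complex.I) ^ a z).re ≤ 0)))))
    {Rc : ℝ}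
    (hRc : ∀ z, (∀ w, dist w (D.boundary (c z)) < Rc → (w ∈ closure D.carrier ↔ ((τ z = 1 → 0 ≤
      ((w - D.boundary (c z)) * (-Complex.I) ^ a z).re ∧ 0 ≤ ((w - D.boundary (c z)) *
      (-Complex.I) ^ a z).im) ∧ (τ z = 2 → 0 ≤ ((w - D.boundary (c z)) * (-Complex.I) ^ a z).im) ∧
      (τ z = 3 → 0 ≤ ((w - D.boundary (c z)) * (-Complex.I) ^ a z).im ∨ ((w - D.boundary (c z)) *
      (-Complex.I) ^ a z).re ≤ 0)))))
    (hash : ∀ (z n : ℤ), a (z + n * M) = a z)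
    {κ₀ : ℝ} (hκ₀ : ∀ z z' : ℤ, z + 2 ≤ z' → z' ≤ z + M - 2 →
      ∀ t ∈ Icc (c z) (c (z + 1)), ∀ t' ∈ Icc (c z') (c (z' + 1)),
        κ₀ ≤ dist (D.boundary t) (D.boundary t'))
    (zm : Fin k → ℤ) (hzm : ∀ i, D.mark i ∈ Ioo (c (zm i)) (c (zm i + 1))) {α : ℝ} {zA : ℤ}
    (hzA0 : a zA = 0) (hαA : α ∈ Ioo (c zA) (c (zA + 1))) (hα0 : 0 ≤ α) (hα1 : α < 1)
    (hαm : ∀ i, D.mark i ≠ α)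
    {η₀ κ₁ dmm dA dmc dAc Λ ℓmin : ℝ} (hη₀ : 0 < η₀)
    (hκ₁ : ∀ s t : ℝ, (∀ n : ℤ, η₀ ≤ |s - t - n|) → κ₁ ≤ dist (D.boundary s) (D.boundary t))
    (hgap1 : ∀ i i', i ≠ i' → ∀ n : ℤ, 2 * η₀ ≤ |D.mark i - D.mark i' - n|)
    (hgap2 : ∀ i, ∀ n : ℤ, 2 * η₀ ≤ |α - D.mark i - n|)
    (hdmm : ∀ i i', i ≠ i' → dmm ≤ dist (D.pt i) (D.pt i'))
    (hdA : ∀ i, dA ≤ dist (D.boundary α) (D.pt i))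
    (hdmc : ∀ i, dmc ≤ ‖D.pt i - D.boundary (c (zm i))‖ ∧ dmc ≤ ‖D.boundary (c (zm i + 1)) - D.pt i‖)
    (hdAc : dAc ≤ ‖D.boundary α - D.boundary (c zA)‖ ∧ dAc ≤ ‖D.boundary (c (zA + 1)) - D.boundary α‖)
    (hΛ : ∀ z, ‖D.boundary (c (z + 1)) - D.boundary (c z)‖ ≤ Λ)
    (hℓmin : ∀ z, ℓmin ≤ ‖D.boundary (c (z + 1)) - D.boundary (c z)‖)
    {δ ρ r s₀ : ℝ} (hδ : 0 < δ) (hδ1 : δ ≤ 1) (hρδ : 64 * δ ≤ ρ) (hρr : ρ ≤ r) (hs₀ : 0 < s₀)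
    (hρR : ρ ≤ Rc)
    (hrκ₀ : 16 * r ≤ κ₀) (hrκ₁ : 16 * r ≤ κ₁) (hrdmm : 16 * r ≤ dmm) (hrdA : 16 * r ≤ dA)
    (hrdmc : 16 * r ≤ dmc) (hrdAc : 16 * r ≤ dAc) (hrℓ : 16 * r ≤ ℓmin) (hs₀A : 4 * s₀ ≤ dA)
    (hs₀Ac : 4 * s₀ ≤ dAc) (hGr : 2 * ((∑ b ∈ Finset.univ.erase j, L b : ℕ) : ℝ) ≤ r / δ)
    {V : Finset (ℤ × ℤ)}
    (hV : ∀ v : ℤ × ℤ, v ∈ V ↔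
      ((v.1 : ℂ) * ((δ : ℝ) : ℂ) + (v.2 : ℂ) * ((δ : ℝ) : ℂ) * Complex.I) ∈ closure D.carrier)
    (p : Fin k → ℤ × ℤ)
    (hpε : ∀ i, dist (((p i).1 : ℂ) * ((δ : ℝ) : ℂ) + ((p i).2 : ℂ) * ((δ : ℝ) : ℂ) * Complex.I)
      (D.pt i) ≤ r / 4)
    (hadm : Literature.Probability.LatticeModels.CollarLegModel.LegInsertionData.IsAdmissible
      (⟨(Finset.univ.erase j).image p, fun v ↦ ∑ b ∈ (Finset.univ.erase j).filter
        (fun b ↦ p b = v), L b, p j⟩ :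
          Literature.Probability.LatticeModels.CollarLegModel.LegInsertionData) V)
    (x : Fin k → ℤ) (hxmono : StrictMono x)
    (hxsep : ∀ i₁ i₂ : Fin k, i₁ ≠ i₂ → (r / δ) ^ 2 ≤ (((x i₁ - x i₂) ^ 2 : ℤ) : ℝ))
    (hxs₀ : ∀ i, (((x i) ^ 2 : ℤ) : ℝ) ≤ (s₀ / δ) ^ 2) :
    ∃ (T : ℕ) (q : ℕ → Fin k → ℤ × ℤ) (σ : ℕ → Bool), q 0 = p ∧ (q T = fun i ↦ (⌊(D.boundary α).re
      / δ⌋ + x i, ⌈(D.boundary (c zA)).im / δ⌉)) ∧ (T : ℝ) * δ ≤ k * ((M + 1) * (Λ + 4)) ∧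
      ((Finset.range T).filter (fun t ↦ σ t = false)).card ≤ k * M ∧ (∀ t, t ≤ T →
      Function.Injective (q t) ∧
      Literature.Probability.LatticeModels.CollarLegModel.LegInsertionData.IsAdmissible
      (⟨(Finset.univ.erase j).image (q t), fun v ↦ ∑ b ∈ (Finset.univ.erase j).filter (fun b ↦ (q
      t) b = v), L b, (q t) j⟩ :
      Literature.Probability.LatticeModels.CollarLegModel.LegInsertionData) V ∧ (∀ i, (∃ d : ℤ ×
      ℤ, (d = (1, 0) ∨ d = (-1, 0) ∨ d = (0, 1) ∨ d = (0, -1)) ∧ ∀ v : ℤ × ℤ, (((((v).1 - (q t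
      i).1) ^ 2 + ((v).2 - (q t i).2) ^ 2 : ℤ) : ℝ)) ≤ (ρ / 4 / δ) ^ 2 → (v ∈ V ↔ 0 ≤ (v.1 - (q t
      i).1) * d.1 + (v.2 - (q t i).2) * d.2))) ∧ (∀ i₁ i₂ : Fin k, i₁ ≠ i₂ → (r / δ) ^ 2 ≤ ((((((q
      t) i₁).1 - ((q t) i₂).1) ^ 2 + (((q t) i₁).2 - ((q t) i₂).2) ^ 2 : ℤ) : ℝ)))) ∧ (∀ t, t < T
      → (σ t = true → ∃ (i : Fin k) (τ : ℤ × ℤ), (τ = (1, 0) ∨ τ = (-1, 0) ∨ τ = (0, 1) ∨ τ = (0,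
      -1)) ∧ q (t + 1) = Function.update (q t) i (q t i + τ)) ∧ (σ t = false → ∃ (i : Fin k) (q' :
      ℤ × ℤ), q (t + 1) = Function.update (q t) i q' ∧ (∀ i', i' ≠ i → (∃ d : ℤ × ℤ, (d = (1, 0) ∨
      d = (-1, 0) ∨ d = (0, 1) ∨ d = (0, -1)) ∧ ∀ v : ℤ × ℤ, (((((v).1 - (q t i').1) ^ 2 + ((v).2
      - (q t i').2) ^ 2 : ℤ) : ℝ)) ≤ (r / δ) ^ 2 → (v ∈ V ↔ 0 ≤ (v.1 - (q t i').1) * d.1 + (v.2 -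
      (q t i').2) * d.2))) ∧ (((((q').1 - (q t i).1) ^ 2 + ((q').2 - (q t i).2) ^ 2 : ℤ) : ℝ)) ≤
      (ρ / δ) ^ 2)) := by
  classical
  have hr : 0 < r := by linarith
  have hδr : 64 * δ ≤ r := hρδ.trans hρr
  have hpt : ∀ i, D.pt i = D.boundary (D.mark i) := fun i => rfl
  obtain ⟨hA, hA', hB⟩ := tp_env D hM2 hcmono hcper ha4 hτ hmodτ hdir hmono hflatch hRc hκ₀ hδ hρδ hρr
    (by linarith) hρR hV
  have hpV := tp_points_of_admissible L j V p hadm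
  have hinit := fun i => tp_init_point D.toJordanDomain hM2 hcmono hcper ha4 hτ hmodτ hdir hmono hflatch
    hκ₀ hδ hV (zm i) (hzm i) (lam := 8 * r) (ε := r / 4) (by linarith)
    (by rw [← hpt]; linarith [(hdmc i).1]) (by rw [← hpt]; linarith [(hdmc i).2]) (by positivity)
    (by linarith) (p i) (hpV i).1 (hpV i).2 (hpε i)
  have han1 : (D.boundary α).re - δ < δ * (⌊(D.boundary α).re / δ⌋ : ℤ) ∧
      δ * (⌊(D.boundary α).re / δ⌋ : ℤ) ≤ (D.boundary α).re := by
    constructor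
    · have := Int.lt_floor_add_one ((D.boundary α).re / δ)
      rw [div_lt_iff₀ hδ] at this
      linarith
    · have := Int.floor_le ((D.boundary α).re / δ)
      rwa [le_div_iff₀ hδ, mul_comm] at this
  have hxs₀' : ∀ i, |δ * (x i : ℤ)| ≤ s₀ := by
    intro i
    have h0 : 0 ≤ s₀ / δ := by positivity
    have h1 : |((x i : ℤ) : ℝ)| ≤ s₀ / δ :=
      (pow_le_pow_iff_left₀ (abs_nonneg _) h0 two_ne_zero).1 (by rw [sq_abs]; exact_mod_cast hxs₀ i)
    rw [abs_mul, abs_of_pos hδ]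
    rw [le_div_iff₀ hδ] at h1
    linarith
  -- the predicates of TRANSPORT
  set Fl : ℤ × ℤ → Prop := (fun u : ℤ × ℤ => ∃ d : ℤ × ℤ, (d = (1, 0) ∨ d = (-1, 0) ∨ d = (0, 1) ∨ d = (0, -1)) ∧ ∀ v : ℤ × ℤ, (((((v).1 - (u).1) ^ 2 + ((v).2 - (u).2) ^ 2 : ℤ) : ℝ)) ≤ (ρ / 4 / δ) ^ 2 → (v ∈ V ↔ 0 ≤ (v.1 - (u).1) * d.1 + (v.2 - (u).2) * d.2)) with hFl
  set FlR : ℤ × ℤ → Prop := (fun u : ℤ × ℤ => ∃ d : ℤ × ℤ, (d = (1, 0) ∨ d = (-1, 0) ∨ d = (0, 1) ∨ d = (0, -1)) ∧ ∀ v : ℤ × ℤ, (((((v).1 - (u).1) ^ 2 + ((v).2 - (u).2) ^ 2 : ℤ) : ℝ)) ≤ (r / δ) ^ 2 → (v ∈ V ↔ 0 ≤ (v.1 - (u).1) * d.1 + (v.2 - (u).2) * d.2)) with hFlR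
  set Sep : ℤ × ℤ → ℤ × ℤ → Prop := (fun u v : ℤ × ℤ => (r / δ) ^ 2 ≤ ((((u.1 - v.1) ^ 2 + (u.2 - v.2) ^ 2 : ℤ)) : ℝ)) with hSep
  set JumpOK : ℤ × ℤ → ℤ × ℤ → Prop := (fun u v : ℤ × ℤ => ((((v.1 - u.1) ^ 2 + (v.2 - u.2) ^ 2 : ℤ)) : ℝ) ≤ (ρ / δ) ^ 2) with hJumpOK
  have hJsym : ∀ u v : ℤ × ℤ, JumpOK u v → JumpOK v u := by
    intro u v h
    simp only [hJumpOK] at h ⊢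
    rw [show (u.1 - v.1) ^ 2 + (u.2 - v.2) ^ 2 = (v.1 - u.1) ^ 2 + (v.2 - u.2) ^ 2 by ring]
    exact h
  have paths := tp_mover_paths D hcmono hcper ha4 hτ hmodτ hdir hmono hash hκ₀ hδ hρδ hρr hs₀ L j
    (∑ b ∈ Finset.univ.erase j, L b) le_rfl hGr (fun z => Fin.ofNat 4 (a z)) (fun z => rfl)
    (fun z => ⌈(D.boundary (c z) * (-Complex.I) ^ (a z)).im / δ⌉) (fun z => rfl)
    (fun z => (((⌈(D.boundary (c (z - 1)) * (-Complex.I) ^ (a (z - 1))).im / δ⌉ • dir ((Fin.ofNat 4 (a (z - 1))) + 1) + ⌈(D.boundary (c z) * (-Complex.I) ^ (a z)).im / δ⌉ • dir ((Fin.ofNat 4 (a z)) + 1)).1 * (dir (Fin.ofNat 4 (a z))).1 + (⌈(D.boundary (c (z - 1)) * (-Complex.I) ^ (a (z - 1))).im / δ⌉ • dir ((Fin.ofNat 4 (a (z - 1))) + 1) + ⌈(D.boundary (c z) * (-Complex.I) ^ (a z)).im / δ⌉ • dir ((Fin.ofNat 4 (a z)) + 1)).2 * (dir (Fin.ofNat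 4 (a z))).2) + ((⌈ρ / 4 / δ⌉₊ + 3 : ℕ) : ℤ)))
    (fun z => (((⌈(D.boundary (c (z - 1)) * (-Complex.I) ^ (a (z - 1))).im / δ⌉ • dir ((Fin.ofNat 4 (a (z - 1))) + 1) + ⌈(D.boundary (c z) * (-Complex.I) ^ (a z)).im / δ⌉ • dir ((Fin.ofNat 4 (a z)) + 1)).1 * (dir (Fin.ofNat 4 (a (z - 1)))).1 + (⌈(D.boundary (c (z - 1)) * (-Complex.I) ^ (a (z - 1))).im / δ⌉ • dir ((Fin.ofNat 4 (a (z - 1))) + 1) + ⌈(D.boundary (c z) * (-Complex.I) ^ (a z)).im / δ⌉ • dir ((Fin.ofNat 4 (a z)) + 1)).2 * (dir (Fin.ofNat 4 (a (z - 1)))).2) - ((⌈ρ / 4 / δ⌉₊ + 3 : ℕ) : ℤ)))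
    Fl FlR Sep JumpOK (fun u v => Iff.rfl) hJsym hA hA' hB zm hzm hzA0 hαA hα0 hα1 hη₀ hκ₁ hgap1 hgap2
    hdmm hdA hdmc hdAc hΛ hℓmin hrκ₀ hrκ₁ hrdmm hrdA hrdmc hrdAc hrℓ hs₀A hs₀Ac p
    (fun i => (p i).1 * (dir (Fin.ofNat 4 (a (zm i)))).1 + (p i).2 * (dir (Fin.ofNat 4 (a (zm i)))).2)
    (fun i => (hinit i).1) (fun i => (hinit i).2) x hxmono hxsep hxs₀' ⌊(D.boundary α).re / δ⌋ han1
  obtain ⟨hFp, -, hSpp, -, -⟩ := tp_parked_facts D hcmono ha4 hdir hmono hδ hδr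
    (fun z => Fin.ofNat 4 (a z)) (fun z => rfl) (fun z => ⌈(D.boundary (c z) * (-Complex.I) ^ (a z)).im / δ⌉) (fun z => rfl)
    Fl FlR Sep (fun u v => Iff.rfl) hA' zm hzm hzA0 hαA hdmm hdA hdmc hdAc hrdmm hrdA hrdmc hrdAc hs₀A
    hs₀Ac p (fun i => (p i).1 * (dir (Fin.ofNat 4 (a (zm i)))).1 + (p i).2 * (dir (Fin.ofNat 4 (a (zm i)))).2)
    (fun i => (hinit i).1) (fun i => (hinit i).2) x hxsep hxs₀' ⌊(D.boundary α).re / δ⌋ han1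
  -- the schedule
  set slot : Fin k → ℤ × ℤ := fun i => (⌊(D.boundary α).re / δ⌋ + x i) • dir (Fin.ofNat 4 (a zA)) +
    ⌈(D.boundary (c zA) * (-Complex.I) ^ (a zA)).im / δ⌉ • dir (Fin.ofNat 4 (a zA) + 1) with hslot
  set ord : List (Fin k) := (List.finRange k).filter (fun i => decide (α < D.mark i)) ++
    ((List.finRange k).filter (fun i => decide (D.mark i < α))).reverse with hord_def
  have hSepne : ∀ u v : ℤ × ℤ, Sep u v → u ≠ v := fun u v h => tp_sep_ne (by positivity) u v h
  have hmover : ∀ (pre post : List (Fin k)) (m : Fin k), ord = pre ++ m :: post →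
      LegInsertionData.IsAdmissible (⟨(Finset.univ.erase j).image ((fun i => if i ∈ pre then slot
      i else p i)), fun v ↦ ∑ b ∈ (Finset.univ.erase j).filter (fun b ↦ ((fun i => if i ∈ pre then
      slot i else p i)) b = v), L b, ((fun i => if i ∈ pre then slot i else p i)) j⟩ :
      LegInsertionData) V → ∃ T : ℕ, T ≤ (fun _ : Fin k => (M + 1) * ((⌈Λ / δ⌉₊ + 2 : ℕ) + 1)) m ∧
      (∃ (q : ℕ → Fin k → ℤ × ℤ) (σ' : ℕ → Bool), q 0 = (fun i => if i ∈ pre then slot i else p i)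
      ∧ q (T) = (fun i => if i ∈ (pre ++ [m]) then slot i else p i) ∧ ((Finset.range (T)).filter
      (fun t => σ' t = false)).card ≤ (fun _ : Fin k => M) m ∧ (∀ t, t ≤ T → (Function.Injective
      (q t) ∧ LegInsertionData.IsAdmissible (⟨(Finset.univ.erase j).image (q t), fun v ↦ ∑ b ∈
      (Finset.univ.erase j).filter (fun b ↦ (q t) b = v), L b, (q t) j⟩ : LegInsertionData) V ∧ (∀
      i, Fl (q t i)) ∧ (∀ i₁ i₂ : Fin k, i₁ ≠ i₂ → Sep (q t i₁) (q t i₂)))) ∧ (∀ t, t < T → (σ' t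
      = true → ∃ (i : Fin k) (τ : ℤ × ℤ), (τ = (1, 0) ∨ τ = (-1, 0) ∨ τ = (0, 1) ∨ τ = (0, -1)) ∧
      q (t + 1) = Function.update (q t) i (q t i + τ)) ∧ (σ' t = false → ∃ (i : Fin k) (q' : ℤ ×
      ℤ), q (t + 1) = Function.update (q t) i q' ∧ (∀ i', i' ≠ i → FlR (q t i')) ∧ JumpOK (q t i)
      q'))) ∧ LegInsertionData.IsAdmissible (⟨(Finset.univ.erase j).image ((fun i => if i ∈ (pre
      ++ [m]) then slot i else p i)), fun v ↦ ∑ b ∈ (Finset.univ.erase j).filter (fun b ↦ ((fun i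
      => if i ∈ (pre ++ [m]) then slot i else p i)) b = v), L b, ((fun i => if i ∈ (pre ++ [m])
      then slot i else p i)) j⟩ : LegInsertionData) V := by
    intro pre post m hord hadmpre
    have hend : ∀ Q : Fin k → ℤ × ℤ, Q = (fun i => if i ∈ pre then slot i else p i) →
        Function.update Q m (slot m) = (fun i => if i ∈ (pre ++ [m]) then slot i else p i) := by
      intro Q hQ; subst hQ
      funext i
      by_cases hi : i = m
      · subst hi; simp
      · rw [Function.update_of_ne hi]; simp [hi]
    rcases lt_or_gt_of_ne (hαm m) with hm | hm
    · obtain ⟨hmpre, hchar⟩ := tp_order_ccw D.mark D.strictMono_mark α hαm hm hord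
      obtain ⟨T, hT, hpath, hadm'⟩ := (paths m _ (by simp [hmpre]) hadmpre).1 hm
        (fun i' hi' => by
          by_cases h : m < i'
          · rw [if_pos h, if_pos ((hchar i' hi').2 h)]
          · rw [if_neg h, if_neg (fun h' => h ((hchar i' hi').1 h'))])
      rw [hend _ rfl] at hpath hadm'
      exact ⟨T, hT, hpath, hadm'⟩
    · obtain ⟨hmpre, hchar⟩ := tp_order_cw D.mark α hm hord
      obtain ⟨T, hT, hpath, hadm'⟩ := (paths m _ (by simp [hmpre]) hadmpre).2 hm
        (fun i' hi' => ⟨fun h1 h2 => by rw [if_pos ((hchar i' hi').2 ⟨h1, h2⟩)],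
          fun h => by rw [if_neg (fun h' => h ((hchar i' hi').1 h'))]⟩)
      rw [hend _ rfl] at hpath hadm'
      exact ⟨T, hT, hpath, hadm'⟩
  obtain ⟨T, hT, q, σ', hq0, hqT, hqc, hqg, hqs⟩ := tp_schedule'' k L j V Fl FlR Sep JumpOK hSepne p slot
    (fun _ => (M + 1) * ((⌈Λ / δ⌉₊ + 2 : ℕ) + 1)) (fun _ => M) ord (fun i => (hFp i).1)
    (fun i₁ i₂ h => hSpp i₁ i₂ h) hmover hadm
  -- the bounds
  have hlen : ord.length ≤ k := by
    have h1 := List.length_filter_le (fun i => decide (α < D.mark i)) (List.finRange k)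
    have h2 := List.length_filter_le (fun i => decide (D.mark i < α)) (List.finRange k)
    rw [List.length_finRange] at h1 h2
    have h3 : ∀ i ∈ (List.finRange k).filter (fun i => decide (α < D.mark i)),
        i ∉ ((List.finRange k).filter (fun i => decide (D.mark i < α))).reverse := by
      intro i hi hi'
      have a1 := (List.mem_filter.1 hi).2
      have a2 := (List.mem_filter.1 (List.mem_reverse.1 hi')).2
      simp at a1 a2; linarith
    have hnd : ord.Nodup := by
      rw [hord_def]
      refine List.nodup_append.2 ⟨(List.nodup_finRange k).filter _,
        List.nodup_reverse.2 ((List.nodup_finRange k).filter _), ?_⟩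
      intro i hi j' hj' hij
      exact h3 i hi (hij ▸ hj')
    simpa using hnd.length_le_card
  have hsumB : (ord.map fun _ => (M + 1) * ((⌈Λ / δ⌉₊ + 2 : ℕ) + 1)).sum =
      ord.length * ((M + 1) * ((⌈Λ / δ⌉₊ + 2 : ℕ) + 1)) := by
    rw [List.map_const', List.sum_replicate, smul_eq_mul]
  have hsumJ : (ord.map fun _ => M).sum = ord.length * M := by
    rw [List.map_const', List.sum_replicate, smul_eq_mul]
  refine ⟨T, q, σ', hq0, ?_, ?_, ?_, hqg, hqs⟩
  · rw [hqT]
    funext i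
    have hi : i ∈ ord := tp_order_mem D.mark α hαm i
    simp only [hi, if_true, hslot]
    rw [hzA0, pow_zero, mul_one]
    exact (tp_slot_point _ _).symm
  · rw [hsumB] at hT
    have hΛ0 : (0 : ℝ) ≤ Λ := (norm_nonneg _).trans (hΛ 0)
    have hW : δ * (((⌈Λ / δ⌉₊ + 2 : ℕ) : ℝ) + 1) ≤ Λ + 4 := by
      have := tp_radius_margin hδ hΛ0
      push_cast at this ⊢; nlinarith
    have hT' : (T : ℝ) ≤ k * ((M + 1) * (((⌈Λ / δ⌉₊ + 2 : ℕ) : ℝ) + 1)) := by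
      have h1 : (T : ℝ) ≤ (ord.length * ((M + 1) * ((⌈Λ / δ⌉₊ + 2 : ℕ) + 1)) : ℕ) := by
        exact_mod_cast hT
      have hl : (ord.length : ℝ) ≤ k := by exact_mod_cast hlen
      have h0 : (0 : ℝ) ≤ (M + 1) * (((⌈Λ / δ⌉₊ + 2 : ℕ) : ℝ) + 1) := by positivity
      have h2 := mul_le_mul_of_nonneg_right hl h0
      push_cast at h1 h2 ⊢
      linarith
    calc (T : ℝ) * δ ≤ k * ((M + 1) * (((⌈Λ / δ⌉₊ + 2 : ℕ) : ℝ) + 1)) * δ :=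
          mul_le_mul_of_nonneg_right hT' hδ.le
      _ = k * ((M + 1) * (δ * (((⌈Λ / δ⌉₊ + 2 : ℕ) : ℝ) + 1))) := by ring
      _ ≤ k * ((M + 1) * (Λ + 4)) := by
          apply mul_le_mul_of_nonneg_left _ (Nat.cast_nonneg _)
          exact mul_le_mul_of_nonneg_left hW (by positivity)
  · rw [hsumJ] at hqc
    exact hqc.trans (Nat.mul_le_mul_right _ hlen)

/-- **Stub (v2) — admissible transport paths (TRANSPORT).** For a rectilinear marked Jordan domain with flat non-corner marks, positively oriented at the sink mark, discretised along a mesh sequence with admissible injective insertion points converging to the marks: there are anchors `a n` on a flat bottom-type stretch of radius `s₀/δ_n` and, for all small `r ≥ ρ > 0`, eventually in `n`, for every target slot vector `x` (strictly increasing, `r/δ_n`-separated, inside the stretch) a finite chain of configurations from `p n` to the slots `((a n).1 + x i, (a n).2)` made of unit slides and at most `N` jumps of length `≤ ρ/δ_n`, all configurations injective, admissible, `ρ/4δ_n`-flat and `r/δ_n`-separated, with `T·δ_n ≤ N` (statement typed by the stub_rigidity worker; consumed verbatim by `s3_rigidityOfTransport(V2)`). [folklore] -/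
theorem stub_transportPaths : ∀ (k : ℕ) (L : Fin k → ℕ) (j : Fin k), L j = ∑ i ∈ Finset.univ.erase j, L i → ∀ (D : Literature.Probability.RandomPlanarGeometry.MarkedDomain k), (∃ S : Finset (ℂ × ℂ), (∀ q ∈ S, q.1.re = q.2.re ∨ q.1.im = q.2.im) ∧ frontier D.carrier ⊆ ⋃ q ∈ S, segment ℝ q.1 q.2) → (∀ i, (∃ r : ℝ, 0 < r ∧ ((∀ z ∈ frontier D.carrier, dist z (D.pt i) < r → z.im = (D.pt i).im) ∨ (∀ z ∈ frontier D.carrier, dist z (D.pt i) < r → z.re = (D.pt i).re)))) → (∃ τ : ℂ, ‖τ‖ = 1 ∧ (∃ ε : ℝ, 0 < ε ∧ ∀ t ∈ Set.Ioo (D.mark j) (D.mark j + ε), ∃ s : ℝ, 0 < s ∧ D.boundary t = D.pt j + (s : ℂ) * τ) ∧ (∃ ε : ℝ, 0 < ε ∧ ∀ s ∈ Set.Ioo (0 : ℝ) ε, D.pt j + (s : ℂ) * (τ * Complex.I) ∈ D.carrier)) → ∀ (δ : ℕ → ℝ), (∀ n, 0 < δ n) → Filter.Tendsto δ Filter.atTop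 (nhds 0) → ∀ (V : ℕ → Finset (ℤ × ℤ)), (∀ n, ∀ v : ℤ × ℤ, v ∈ V n ↔ (((v).1 : ℂ) * ((δ n : ℝ) : ℂ) + ((v).2 : ℂ) * ((δ n : ℝ) : ℂ) * Complex.I) ∈ closure D.carrier) → ∀ (p : ℕ → Fin k → ℤ × ℤ), (∀ n, Function.Injective ((p) n)) → (∀ i, Filter.Tendsto (fun n ↦ ((((p) n i).1 : ℂ) * ((δ n : ℝ) : ℂ) + (((p) n i).2 : ℂ) * ((δ n : ℝ) : ℂ) * Complex.I)) Filter.atTop (nhds (D.pt i))) → (∀ n, Literature.Probability.LatticeModels.CollarLegModel.LegInsertionData.IsAdmissible (⟨(Finset.univ.erase j).image ((p) n), fun v ↦ ∑ b ∈ (Finset.univ.erase j).filter (fun b ↦ ((p) n) b = v), L b, ((p) n) j⟩ : Literature.Probability.LatticeModels.CollarLegModel.LegInsertionData) (V n)) → ∃ (a : ℕ → ℤ × ℤ) (s₀ r₀ : ℝ) (N : ℕ), 0 < s₀ ∧ 0 < r₀ ∧ (∀ᶠ n in Filter.atTop, ∀ v : ℤ × ℤ, (((((v).1 - (a n).1)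 ^ 2 + ((v).2 - (a n).2) ^ 2 : ℤ) : ℝ)) ≤ (s₀ / δ n) ^ 2 → (v ∈ V n ↔ 0 ≤ v.2 - (a n).2)) ∧ ∀ (r : ℝ), 0 < r → r ≤ r₀ → ∀ (ρ : ℝ), 0 < ρ → ρ ≤ r → ∀ᶠ n in Filter.atTop, ∀ (x : Fin k → ℤ), StrictMono x → (∀ i₁ i₂ : Fin k, i₁ ≠ i₂ → (r / δ n) ^ 2 ≤ (((x i₁ - x i₂) ^ 2 : ℤ) : ℝ)) → (∀ i, (((x i) ^ 2 : ℤ) : ℝ) ≤ (s₀ / δ n) ^ 2) → ∃ (T : ℕ) (q : ℕ → Fin k → ℤ × ℤ) (σ : ℕ → Bool), q 0 = p n ∧ (q T = fun i ↦ ((a n).1 + x i, (a n).2)) ∧ (T : ℝ) * δ n ≤ N ∧ ((Finset.range T).filter (fun t ↦ σ t = false)).card ≤ N ∧ (∀ t, t ≤ T → Function.Injective (q t) ∧ Literature.Probability.LatticeModels.CollarLegModel.LegInsertionData.IsAdmissible (⟨(Finset.univ.erase j).image (q t), fun v ↦ ∑ b ∈ (Finset.univ.erase j).filter (fun b ↦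 (q t) b = v), L b, (q t) j⟩ : Literature.Probability.LatticeModels.CollarLegModel.LegInsertionData) (V n) ∧ (∀ i, (∃ d : ℤ × ℤ, (d = (1, 0) ∨ d = (-1, 0) ∨ d = (0, 1) ∨ d = (0, -1)) ∧ ∀ v : ℤ × ℤ, (((((v).1 - (q t i).1) ^ 2 + ((v).2 - (q t i).2) ^ 2 : ℤ) : ℝ)) ≤ (ρ / 4 / δ n) ^ 2 → (v ∈ V n ↔ 0 ≤ (v.1 - (q t i).1) * d.1 + (v.2 - (q t i).2) * d.2))) ∧ (∀ i₁ i₂ : Fin k, i₁ ≠ i₂ → (r / δ n) ^ 2 ≤ ((((((q t) i₁).1 - ((q t) i₂).1) ^ 2 + (((q t) i₁).2 - ((q t) i₂).2) ^ 2 : ℤ) : ℝ)))) ∧ (∀ t, t < T → (σ t = true → ∃ (i : Fin k) (τ : ℤ × ℤ), (τ = (1, 0) ∨ τ = (-1, 0) ∨ τ = (0, 1) ∨ τ = (0, -1)) ∧ q (t + 1) = Function.update (q t) i (q t i + τ)) ∧ (σ t = false → ∃ (i : Fin k) (q' : ℤ × ℤ), q (t + 1) = Function.update (q t) i q' ∧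 (∀ i', i' ≠ i → (∃ d : ℤ × ℤ, (d = (1, 0) ∨ d = (-1, 0) ∨ d = (0, 1) ∨ d = (0, -1)) ∧ ∀ v : ℤ × ℤ, (((((v).1 - (q t i').1) ^ 2 + ((v).2 - (q t i').2) ^ 2 : ℤ) : ℝ)) ≤ (r / δ n) ^ 2 → (v ∈ V n ↔ 0 ≤ (v.1 - (q t i').1) * d.1 + (v.2 - (q t i').2) * d.2))) ∧ (((((q').1 - (q t i).1) ^ 2 + ((q').2 - (q t i).2) ^ 2 : ℤ) : ℝ)) ≤ (ρ / δ n) ^ 2)) := by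
  intro k L j _ D hRect hFlat hOR δ hδ hδ0 V hV p _ hpconv hadm
  classical
  obtain ⟨S, hS, hcov⟩ := hRect
  -------------------------------------------------------------- the continuum constants
  obtain ⟨M, c, a, τ, hM2, hcmono, hcper, -, ha4, hτ, hmodτ, hdir, hmono, hcorner, -, hcornerch,
    hflatch, z₀, hz₀⟩ := tp_polygon D.toJordanDomain hS hcov (t₁ := D.mark j) hOR
  have hM : 0 < M := by omega
  obtain ⟨κ₀, hκ₀pos, hκ₀⟩ := tp_nonadjacent_dist D.toJordanDomain hM2 hcmono hcper
  have hash := tp_a_shift D.toJordanDomain hcmono hcper ha4 hdir hmono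
  have hτsh := tp_τ_shift hτ hmodτ hash
  obtain ⟨Rc, hRcpos, hRc⟩ := tp_corner_radius D.toJordanDomain hM hcper hash hτsh hcornerch
  obtain ⟨ℓmin, Λ, hℓminpos, hℓ⟩ := tp_edge_lengths D.toJordanDomain hM hcmono hcper hmono
  obtain ⟨zm, α, zA, η₀, dmm, dA, hzm, hzA0, hαA, hα01, hαm', hη₀, hη₀4, hgap1, hgap2, hdmmpos, hdmm,
    hdApos, hdA⟩ := tp_marks_anchor D hM2 hcmono hcper hcorner hash hz₀ hFlat
  have hαm : ∀ i, D.mark i ≠ α := fun i h => hαm' i 0 (by rw [h]; simp)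
  obtain ⟨κ₁, hκ₁pos, hκ₁⟩ := tp_tube D.toJordanDomain hη₀ (by linarith)
  obtain ⟨dmc, hdmcpos, hdmc⟩ := tp_mark_corner_dist D hcmono hdir hmono zm hzm
  obtain ⟨hA1, hA2, -⟩ := tp_inside_dist D.toJordanDomain hcmono hdir hmono zA hαA
  set dAc := min ‖D.boundary α - D.boundary (c zA)‖ ‖D.boundary (c (zA + 1)) - D.boundary α‖ with hdAc_def
  have hdAcpos : 0 < dAc := lt_min hA1 hA2
  have hdAc : dAc ≤ ‖D.boundary α - D.boundary (c zA)‖ ∧ dAc ≤ ‖D.boundary (c (zA + 1)) - D.boundary α‖ :=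
    ⟨min_le_left _ _, min_le_right _ _⟩
  -- the scales
  set s₀ := min dA (min dAc κ₀) / 4 with hs₀_def
  have hs₀ : 0 < s₀ := by rw [hs₀_def]; exact div_pos (lt_min hdApos (lt_min hdAcpos hκ₀pos)) four_pos
  have hs₀A : 4 * s₀ ≤ dA := by rw [hs₀_def]; linarith [min_le_left dA (min dAc κ₀)]
  have hs₀Ac : 4 * s₀ ≤ dAc := by
    rw [hs₀_def]; linarith [min_le_right dA (min dAc κ₀), min_le_left dAc κ₀]
  have hs₀κ : 4 * s₀ ≤ κ₀ := by
    rw [hs₀_def]; linarith [min_le_right dA (min dAc κ₀), min_le_right dAc κ₀]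
  set m₀ := min (min (min κ₀ κ₁) (min dmm dA)) (min (min dmc dAc) (min ℓmin Rc)) with hm₀_def
  have hm₀pos : 0 < m₀ := lt_min (lt_min (lt_min hκ₀pos hκ₁pos) (lt_min hdmmpos hdApos))
    (lt_min (lt_min hdmcpos hdAcpos) (lt_min hℓminpos hRcpos))
  have hm₁ : m₀ ≤ κ₀ ∧ m₀ ≤ κ₁ ∧ m₀ ≤ dmm ∧ m₀ ≤ dA ∧ m₀ ≤ dmc ∧ m₀ ≤ dAc ∧ m₀ ≤ ℓmin ∧ m₀ ≤ Rc := by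
    simp only [hm₀_def, min_le_iff, le_refl, true_or, or_true, and_self]
  set r₀ := m₀ / 16 with hr₀_def
  have hr₀ : 0 < r₀ := by positivity
  set N : ℕ := k * ((M + 1) * (⌈Λ⌉₊ + 5)) with hN_def
  refine ⟨fun n => (⌊(D.boundary α).re / δ n⌋, ⌈(D.boundary (c zA)).im / δ n⌉), s₀, r₀, N, hs₀, hr₀,
    ?_, ?_⟩
  · ------------------------------------------------------------ the anchor chart
    have hev : ∀ᶠ n in atTop, δ n < s₀ / 3 := hδ0 (Iio_mem_nhds (by positivity))
    filter_upwards [hev] with n hn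
    exact tp_anchor_chart D hM2 hcmono hcper ha4 hτ hmodτ hdir hmono hflatch hκ₀ hzA0 hαA (hδ n)
      (by linarith) (by linarith) (by linarith) hdAc (hV n)
  · ------------------------------------------------------------ the transport paths
    intro r hr hrr₀ ρ hρ hρr
    have hr16 : 16 * r ≤ m₀ := by rw [hr₀_def] at hrr₀; linarith
    set G : ℕ := ∑ b ∈ Finset.univ.erase j, L b with hG_def
    have hev1 : ∀ᶠ n in atTop, δ n < min (ρ / 64) (min 1 (r / (2 * G + 1))) :=
      hδ0 (Iio_mem_nhds (lt_min (by positivity) (lt_min one_pos (by positivity))))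
    have hev2 : ∀ᶠ n in atTop, ∀ i, dist ((((p n i).1 : ℂ) * ((δ n : ℝ) : ℂ) +
        ((p n i).2 : ℂ) * ((δ n : ℝ) : ℂ) * Complex.I)) (D.pt i) ≤ r / 4 :=
      eventually_all.2 fun i => (hpconv i).eventually (closedBall_mem_nhds (D.pt i) (by positivity))
    filter_upwards [hev1, hev2] with n hn1 hn2
    intro x hxmono hxsep hxs₀
    have hd1 : δ n < ρ / 64 := lt_of_lt_of_le hn1 (min_le_left _ _)
    have hd2 : δ n < 1 := lt_of_lt_of_le hn1 ((min_le_right _ _).trans (min_le_left _ _))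
    have hd3 : δ n < r / (2 * G + 1) := lt_of_lt_of_le hn1 ((min_le_right _ _).trans (min_le_right _ _))
    have hGr : 2 * (G : ℝ) ≤ r / δ n := by
      rw [le_div_iff₀ (hδ n)]
      rw [lt_div_iff₀ (by positivity)] at hd3
      have : (0 : ℝ) ≤ G := Nat.cast_nonneg _
      nlinarith [hδ n]
    obtain ⟨T, q, σ, hq0, hqT, hTδ, hjmp, hgood, hstep⟩ := tp_lattice_stage D L j hM2 hcmono hcper ha4
      hτ hmodτ hdir hmono hflatch hRc hash hκ₀ zm hzm hzA0 hαA hα01.1 hα01.2 hαm hη₀ hκ₁ hgap1 hgap2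
      hdmm hdA hdmc hdAc (fun z => (hℓ z).2) (fun z => (hℓ z).1) (hδ n) hd2.le (by linarith) hρr hs₀
      (by linarith [hm₁.2.2.2.2.2.2.2]) (by linarith [hm₁.1]) (by linarith [hm₁.2.1])
      (by linarith [hm₁.2.2.1]) (by linarith [hm₁.2.2.2.1]) (by linarith [hm₁.2.2.2.2.1])
      (by linarith [hm₁.2.2.2.2.2.1]) (by linarith [hm₁.2.2.2.2.2.2.1]) hs₀A hs₀Ac hGr (hV n) (p n)
      hn2 (hadm n) x hxmono hxsep hxs₀
    refine ⟨T, q, σ, hq0, hqT, ?_, ?_, hgood, hstep⟩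
    · refine hTδ.trans ?_
      rw [hN_def]; push_cast
      have hΛ : Λ ≤ (⌈Λ⌉₊ : ℕ) := Nat.le_ceil _
      have : (0 : ℝ) ≤ (k : ℝ) * ((M : ℝ) + 1) := by positivity
      nlinarith
    · refine hjmp.trans ?_
      rw [hN_def]
      exact Nat.mul_le_mul_left _ ((Nat.le_mul_of_pos_right _ (by omega)).trans
        (Nat.mul_le_mul_right _ (Nat.le_succ _)))

end Summit.CriticalPhenomena.CardyFormulaZ2.Cruxes.BoundaryDefectGaussianR.RainbowMonomialsInExcursionKernels

end
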